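import Summits.CriticalPhenomena.PercolationContinuityZ3.Theorems.PercNearOneGluingNoHeavyLowerTailSahiE3TwoPrimeSlot
import Literature.Probability.LatticeModels.SahiThirdOrderCorrelation
import Mathlib.Tactic.Linarith
import Mathlib.Tactic.Ring
import Mathlib.Tactic.Positivity
import HarnessLib
import HarnessLib.Audit

/-!
# `NoHeavyLowerTail` (crux stmt-CriticalPhenomena-4575), Sahi programme P4 (Holley / monotone coupling):
# FILTER-LOCALITY OF A SLOT — `E₃` only grows when a triple living in a principal filter is seen from the ambient measure

Support file (cell `prim-l12`, seat P4, generation 8; `--supports stmt-CriticalPhenomena-4575`).  No named facts, no sorries; standard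
axioms; def-free.

## The lemma (new)

Let `L` be a finite distributive lattice, `μ ≥ 0` log-supermodular (not normalised, `Z = m(L)`), `A, B` up-sets, and `U` an up-set
contained in a principal filter `F = ↑f`.  Write `μ_F = μ·1_F` (again log-supermodular).  Then

  `latticeE3_restrict_principalUp_le`:  `Z² · latticeE3 μ_F U A B ≤ m(F)² · latticeE3 μ U A B`,

i.e. in normalised form `E₃^μ(1_U, 1_A, 1_B) ≥ μ(F)·E₃^{μ(·|F)}(1_U, 1_A, 1_B)`.  So Sahi's inequality `C₃` for the triple
`(U, A ∩ F, B ∩ F)` under the conditioned (smaller) FKG measure `μ(·|F)` implies `C₃` for `(U, A, B)` under `μ`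
(`latticeE3_nonneg_of_restrict_principalUp`); equivalently, a lattice-minimal counterexample to Kahn's Conjecture 5 / Sahi's `C₃`
has all three slots CENTRE-LESS (the meet of the minimal elements of each slot is `⊥`).

PROOF.  With `p = m(F)`, `u = m(U)`, `a = m(A)`, `a₁ = m(A ∩ F)`, …, the `2Z²m(U∩A∩B)` terms cancel and
`p²·E − Z²·E_F = Z·u·p·W + Z·X·Cov_B + Z·Y·Cov_A + u·X·Y` (`restrict_identity`, checked by `ring`) where
`X = Z·a₁ − p·a`, `Y = Z·b₁ − p·b`, `W = Z·c₁ − p·c` are FKG lifts (`m(A)m(F) ≤ Z m(A∩F)`, `fkg_upperSet_mass`) and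
`Cov_A = p·m(U∩A) − u·a₁`, `Cov_B = p·m(U∩B) − u·b₁` are FKG covariances under `μ_F` (`fkg_upperSet_mass_principal`), all `≥ 0`.
The algebraic core `latticeE3_restrict_le_of_lifts` is stated for an arbitrary finite set `F ⊇ U` under these five hypotheses
(for `F = U` it is Blinovsky's reduction `latticeE3_condCov_le`).

## Consequence: a new unconditional slot class (every finite distributive lattice, every FKG weight)

  `latticeE3_nonneg_of_sup_supPrime_union`:  `0 ≤ latticeE3 μ (↑(f ⊔ j₁) ∪ ↑(f ⊔ j₂)) A B`  for ANY `f` and join-primes `j₁, j₂`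

(on the cube: slots `x_S · (x_a ∨ x_b)`), by the lemma and the two-prime slot theorem `…SahiE3TwoPrimeSlot.latticeE3_nonneg_of_supPrime_union`
applied to `μ_F` on `L` (where the slot coincides with `↑j₁ ∪ ↑j₂` on the support of `μ_F`).  Slot-permuted forms `…₂`, `…₃`.
-/

namespace Summit.CriticalPhenomena.PercolationContinuityZ3.Theorems.SahiE3FilterRestriction

open Finset Literature.Probability.LatticeModels
open scoped BigOperators

/-- The algebraic identity behind filter-locality: with `E = 2Z²m₃ + uab − Z(uc + a·ub + b·ua)` (Sahi's functional under `μ`)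
and `E_F = 2p²m₃ + ua₁b₁ − p(uc₁ + a₁·ub + b₁·ua)` (the same under `μ·1_F`),
`p²E − Z²E_F = Z u p (Zc₁ − pc) + Z(Za₁ − pa)(p·ub − u b₁) + Z(Zb₁ − pb)(p·ua − u a₁) + u(Za₁ − pa)(Zb₁ − pb)`. [this work] -/
theorem restrict_identity {R : Type*} [CommRing R] (Z p u a b c a₁ b₁ c₁ ua ub m₃ : R) :
    p ^ 2 * (2 * Z ^ 2 * m₃ + u * a * b - Z * (u * c + a * ub + b * ua))
      - Z ^ 2 * (2 * p ^ 2 * m₃ + u * a₁ * b₁ - p * (u * c₁ + a₁ * ub + b₁ * ua)) =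
    Z * u * p * (Z * c₁ - p * c) + Z * (Z * a₁ - p * a) * (p * ub - u * b₁) + Z * (Z * b₁ - p * b) * (p * ua - u * a₁)
      + u * (Z * a₁ - p * a) * (Z * b₁ - p * b) := by
  ring

variable {α : Type*} [DistribLattice α] [Fintype α] [DecidableEq α]

omit [DistribLattice α] [Fintype α] in
/-- Masses under the restricted weight `μ·1_F` are masses of the trace on `F`. [folklore] -/
theorem mass_restrict (μ : α → ℝ) (F S : Finset α) :
    mass (fun x => if x ∈ F then μ x else 0) S = mass μ (S ∩ F) := by
  unfold mass
  rw [← Finset.sum_filter, Finset.filter_mem_eq_inter]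

omit [DistribLattice α] in
/-- **Filter-locality, algebraic core.**  For a nonnegative weight, finite sets `U ⊆ F`, `A`, `B`, if the three "lifts"
`m(F)m(A) ≤ Z m(A∩F)`, `m(F)m(B) ≤ Z m(B∩F)`, `m(F)m(A∩B) ≤ Z m(A∩B∩F)` and the two "covariances on `F`"
`m(U)m(A∩F) ≤ m(F)m(U∩A)`, `m(U)m(B∩F) ≤ m(F)m(U∩B)` are nonnegative, then `Z²·latticeE3 (μ·1_F) U A B ≤ m(F)²·latticeE3 μ U A B`.
(For `F = U` this is Blinovsky's reduction.) [this work] -/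
theorem latticeE3_restrict_le_of_lifts {μ : α → ℝ} (hμ₀ : 0 ≤ μ) {F U A B : Finset α} (hUF : U ⊆ F)
    (hX : mass μ F * mass μ A ≤ mass μ univ * mass μ (A ∩ F))
    (hY : mass μ F * mass μ B ≤ mass μ univ * mass μ (B ∩ F))
    (hW : mass μ F * mass μ (A ∩ B) ≤ mass μ univ * mass μ (A ∩ B ∩ F))
    (hCA : mass μ U * mass μ (A ∩ F) ≤ mass μ F * mass μ (U ∩ A))
    (hCB : mass μ U * mass μ (B ∩ F) ≤ mass μ F * mass μ (U ∩ B)) :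
    mass μ univ ^ 2 * latticeE3 (fun x => if x ∈ F then μ x else 0) U A B ≤ mass μ F ^ 2 * latticeE3 μ U A B := by
  have e1 : mass (fun x => if x ∈ F then μ x else 0) (U ∩ A ∩ B) = mass μ (U ∩ A ∩ B) := by
    rw [mass_restrict, Finset.inter_eq_left.2 ((Finset.inter_subset_left.trans Finset.inter_subset_left).trans hUF)]
  have e2 : mass (fun x => if x ∈ F then μ x else 0) U = mass μ U := by
    rw [mass_restrict, Finset.inter_eq_left.2 hUF]
  have e3 : mass (fun x => if x ∈ F then μ x else 0) A = mass μ (A ∩ F) := mass_restrict μ F A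
  have e4 : mass (fun x => if x ∈ F then μ x else 0) B = mass μ (B ∩ F) := mass_restrict μ F B
  have e5 : mass (fun x => if x ∈ F then μ x else 0) (A ∩ B) = mass μ (A ∩ B ∩ F) := mass_restrict μ F (A ∩ B)
  have e6 : mass (fun x => if x ∈ F then μ x else 0) (U ∩ B) = mass μ (U ∩ B) := by
    rw [mass_restrict, Finset.inter_eq_left.2 (Finset.inter_subset_left.trans hUF)]
  have e7 : mass (fun x => if x ∈ F then μ x else 0) (U ∩ A) = mass μ (U ∩ A) := by
    rw [mass_restrict, Finset.inter_eq_left.2 (Finset.inter_subset_left.trans hUF)]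
  have e8 : mass (fun x => if x ∈ F then μ x else 0) univ = mass μ F := by rw [mass_restrict, Finset.univ_inter]
  unfold latticeE3
  rw [e1, e2, e3, e4, e5, e6, e7, e8]
  have key := restrict_identity (mass μ univ) (mass μ F) (mass μ U) (mass μ A) (mass μ B) (mass μ (A ∩ B))
    (mass μ (A ∩ F)) (mass μ (B ∩ F)) (mass μ (A ∩ B ∩ F)) (mass μ (U ∩ A)) (mass μ (U ∩ B)) (mass μ (U ∩ A ∩ B))
  have hZ := mass_nonneg hμ₀ (univ : Finset α)
  have hp := mass_nonneg hμ₀ F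
  have hu := mass_nonneg hμ₀ U
  have t1 : 0 ≤ mass μ univ * mass μ U * mass μ F * (mass μ univ * mass μ (A ∩ B ∩ F) - mass μ F * mass μ (A ∩ B)) :=
    mul_nonneg (mul_nonneg (mul_nonneg hZ hu) hp) (by linarith)
  have t2 : 0 ≤ mass μ univ * (mass μ univ * mass μ (A ∩ F) - mass μ F * mass μ A)
      * (mass μ F * mass μ (U ∩ B) - mass μ U * mass μ (B ∩ F)) :=
    mul_nonneg (mul_nonneg hZ (by linarith)) (by linarith)
  have t3 : 0 ≤ mass μ univ * (mass μ univ * mass μ (B ∩ F) - mass μ F * mass μ B)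
      * (mass μ F * mass μ (U ∩ A) - mass μ U * mass μ (A ∩ F)) :=
    mul_nonneg (mul_nonneg hZ (by linarith)) (by linarith)
  have t4 : 0 ≤ mass μ U * (mass μ univ * mass μ (A ∩ F) - mass μ F * mass μ A)
      * (mass μ univ * mass μ (B ∩ F) - mass μ F * mass μ B) :=
    mul_nonneg (mul_nonneg hu (by linarith)) (by linarith)
  nlinarith [key, t1, t2, t3, t4]

variable [DecidableLE α]

/-- The restricted weight `μ·1_{↑f}` written with `principalUp`. [folklore] -/
theorem restrict_principalUp_eq (μ : α → ℝ) (f : α) :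
    (fun x => if x ∈ principalUp f then μ x else 0) = fun x => if f ≤ x then μ x else 0 := by
  funext x
  by_cases h : f ≤ x
  · rw [if_pos h, if_pos (mem_principalUp.2 h)]
  · rw [if_neg h, if_neg (fun h' => h (mem_principalUp.1 h'))]

/-- **Filter-locality of a slot.**  For up-sets `A, B`, an up-set `U` contained in the principal filter `F = ↑f`, and a nonnegative
log-supermodular weight: `Z²·latticeE3 (μ·1_F) U A B ≤ m(F)²·latticeE3 μ U A B` — Sahi's functional under `μ` dominates
`μ(F)` times the functional under the conditioned measure `μ(·|F)`. [this work] -/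
theorem latticeE3_restrict_principalUp_le {μ : α → ℝ} (hμ₀ : 0 ≤ μ) (hμ : ∀ a b, μ a * μ b ≤ μ (a ⊓ b) * μ (a ⊔ b))
    (f : α) {U A B : Finset α} (hUF : U ⊆ principalUp f) (hU : IsUpperSet (U : Set α))
    (hA : IsUpperSet (A : Set α)) (hB : IsUpperSet (B : Set α)) :
    mass μ univ ^ 2 * latticeE3 (fun x => if f ≤ x then μ x else 0) U A B ≤ mass μ (principalUp f) ^ 2 * latticeE3 μ U A B := by
  rw [← restrict_principalUp_eq]
  have hF := isUpperSet_principalUp (α := α) f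
  have hAB : IsUpperSet ((A ∩ B : Finset α) : Set α) := by rw [Finset.coe_inter]; exact hA.inter hB
  refine latticeE3_restrict_le_of_lifts hμ₀ hUF ?_ ?_ ?_ ?_ ?_
  · have h := fkg_upperSet_mass hμ₀ hμ hF hA
    rw [Finset.inter_comm (principalUp f) A] at h; linarith
  · have h := fkg_upperSet_mass hμ₀ hμ hF hB
    rw [Finset.inter_comm (principalUp f) B] at h; linarith
  · have h := fkg_upperSet_mass hμ₀ hμ hF hAB
    rw [Finset.inter_comm (principalUp f) (A ∩ B)] at h; linarith
  · have h := fkg_upperSet_mass_principal hμ₀ hμ hU hA f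
    rw [Finset.inter_eq_left.2 hUF, show U ∩ A ∩ principalUp f = U ∩ A by
      rw [Finset.inter_assoc, Finset.inter_comm A, ← Finset.inter_assoc, Finset.inter_eq_left.2 hUF]] at h
    linarith
  · have h := fkg_upperSet_mass_principal hμ₀ hμ hU hB f
    rw [Finset.inter_eq_left.2 hUF, show U ∩ B ∩ principalUp f = U ∩ B by
      rw [Finset.inter_assoc, Finset.inter_comm B, ← Finset.inter_assoc, Finset.inter_eq_left.2 hUF]] at h
    linarith

/-- **`C₃` transfers from the filter.**  If `U ⊆ ↑f` and Sahi's inequality holds for `(U, A, B)` under the restricted weight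
`μ·1_{↑f}`, then it holds under `μ`. [this work] -/
theorem latticeE3_nonneg_of_restrict_principalUp {μ : α → ℝ} (hμ₀ : 0 ≤ μ) (hμ : ∀ a b, μ a * μ b ≤ μ (a ⊓ b) * μ (a ⊔ b))
    (f : α) {U A B : Finset α} (hUF : U ⊆ principalUp f) (hU : IsUpperSet (U : Set α))
    (hA : IsUpperSet (A : Set α)) (hB : IsUpperSet (B : Set α))
    (h : 0 ≤ latticeE3 (fun x => if f ≤ x then μ x else 0) U A B) : 0 ≤ latticeE3 μ U A B := by
  have key := latticeE3_restrict_principalUp_le hμ₀ hμ f hUF hU hA hB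
  have hZ := mass_nonneg hμ₀ (univ : Finset α)
  rcases (mass_nonneg hμ₀ (principalUp f)).eq_or_lt with hp | hp
  · -- degenerate case `m(↑f) = 0`: every mass inside `U` vanishes and `latticeE3 μ U A B = 0`
    have hz : ∀ S : Finset α, S ⊆ U → mass μ S = 0 := fun S hS =>
      le_antisymm (hp ▸ mass_mono hμ₀ (hS.trans hUF)) (mass_nonneg hμ₀ S)
    unfold latticeE3
    rw [hz U le_rfl, hz (U ∩ A ∩ B) (by intro x hx; simp only [Finset.mem_inter] at hx; exact hx.1.1),
      hz (U ∩ B) Finset.inter_subset_left, hz (U ∩ A) Finset.inter_subset_left]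
    ring_nf; exact le_rfl
  · have h2 : 0 ≤ mass μ (principalUp f) ^ 2 * latticeE3 μ U A B :=
      le_trans (mul_nonneg (pow_nonneg hZ 2) h) key
    exact nonneg_of_mul_nonneg_right h2 (pow_pos hp 2)

/-! ### The new class: `U = ↑(f ⊔ j₁) ∪ ↑(f ⊔ j₂)` with `j₁, j₂` join-prime -/

omit [DistribLattice α] [Fintype α] [DecidableLE α] in
/-- Two finite sets with the same trace on `F` have the same mass under `μ·1_F`. [folklore] -/
theorem mass_restrict_congr (μ : α → ℝ) {F S T : Finset α} (h : S ∩ F = T ∩ F) :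
    mass (fun x => if x ∈ F then μ x else 0) S = mass (fun x => if x ∈ F then μ x else 0) T := by
  rw [mass_restrict, mass_restrict, h]

omit [DistribLattice α] [DecidableLE α] in
/-- `latticeE3` under `μ·1_F` only depends on the trace of the first slot on `F`. [this work] -/
theorem latticeE3_restrict_congr (μ : α → ℝ) {F U V : Finset α} (h : U ∩ F = V ∩ F) (A B : Finset α) :
    latticeE3 (fun x => if x ∈ F then μ x else 0) U A B = latticeE3 (fun x => if x ∈ F then μ x else 0) V A B := by
  have h1 : U ∩ A ∩ B ∩ F = V ∩ A ∩ B ∩ F := by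
    rw [show U ∩ A ∩ B ∩ F = (U ∩ F) ∩ (A ∩ B) by ext x; simp only [Finset.mem_inter]; tauto, h]
    ext x; simp only [Finset.mem_inter]; tauto
  have h2 : U ∩ B ∩ F = V ∩ B ∩ F := by
    rw [show U ∩ B ∩ F = (U ∩ F) ∩ B by ext x; simp only [Finset.mem_inter]; tauto, h]
    ext x; simp only [Finset.mem_inter]; tauto
  have h3 : U ∩ A ∩ F = V ∩ A ∩ F := by
    rw [show U ∩ A ∩ F = (U ∩ F) ∩ A by ext x; simp only [Finset.mem_inter]; tauto, h]
    ext x; simp only [Finset.mem_inter]; tauto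
  unfold latticeE3
  rw [mass_restrict_congr μ h1, mass_restrict_congr μ h, mass_restrict_congr μ h2, mass_restrict_congr μ h3]

/-- **Sahi's `C₃` for the slot `↑(f ⊔ j₁) ∪ ↑(f ⊔ j₂)`** (`f` arbitrary, `j₁, j₂` join-prime; on the cube: `x_S·(x_a ∨ x_b)`), for
all up-sets `A, B` and every nonnegative log-supermodular weight on a finite distributive lattice: filter-locality + the
two-prime slot theorem for the restricted weight `μ·1_{↑f}`. [this work] -/
theorem latticeE3_nonneg_of_sup_supPrime_union {μ : α → ℝ} (hμ₀ : 0 ≤ μ)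
    (hμ : ∀ a b, μ a * μ b ≤ μ (a ⊓ b) * μ (a ⊔ b)) (f : α) {j₁ j₂ : α} (hj₁ : SupPrime j₁) (hj₂ : SupPrime j₂)
    {A B : Finset α} (hA : IsUpperSet (A : Set α)) (hB : IsUpperSet (B : Set α)) :
    0 ≤ latticeE3 μ (principalUp (f ⊔ j₁) ∪ principalUp (f ⊔ j₂)) A B := by
  have hUF : principalUp (f ⊔ j₁) ∪ principalUp (f ⊔ j₂) ⊆ principalUp f := by
    intro x hx
    rw [Finset.mem_union, mem_principalUp, mem_principalUp] at hx
    rw [mem_principalUp]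
    rcases hx with h | h
    · exact le_trans le_sup_left h
    · exact le_trans le_sup_left h
  have hU : IsUpperSet ((principalUp (f ⊔ j₁) ∪ principalUp (f ⊔ j₂) : Finset α) : Set α) := by
    rw [Finset.coe_union]; exact (isUpperSet_principalUp _).union (isUpperSet_principalUp _)
  refine latticeE3_nonneg_of_restrict_principalUp hμ₀ hμ f hUF hU hA hB ?_
  -- the restricted weight is nonnegative and log-supermodular
  have hν₀ : 0 ≤ (fun x => if f ≤ x then μ x else 0) := fun x => by
    dsimp only; split_ifs
    · exact hμ₀ x
    · exact le_rfl
  have hν := logSupermodular_restrict_principal hμ₀ hμ f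
  -- on the support of the restricted weight the slot is the two-prime slot `↑j₁ ∪ ↑j₂`
  have htr : (principalUp (f ⊔ j₁) ∪ principalUp (f ⊔ j₂)) ∩ principalUp f = (principalUp j₁ ∪ principalUp j₂) ∩ principalUp f := by
    ext x
    simp only [Finset.mem_inter, Finset.mem_union, mem_principalUp, sup_le_iff]
    constructor
    · rintro ⟨h | h, hf⟩
      · exact ⟨Or.inl h.2, hf⟩
      · exact ⟨Or.inr h.2, hf⟩
    · rintro ⟨h | h, hf⟩
      · exact ⟨Or.inl ⟨hf, h⟩, hf⟩
      · exact ⟨Or.inr ⟨hf, h⟩, hf⟩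
  have key := SahiE3TwoPrimeSlot.latticeE3_nonneg_of_supPrime_union hν₀ hν hj₁ hj₂ hA hB
  rw [← restrict_principalUp_eq] at key ⊢
  rw [latticeE3_restrict_congr μ htr]
  exact key

/-- The same slot in the second position. [this work] -/
theorem latticeE3_nonneg_of_sup_supPrime_union₂ {μ : α → ℝ} (hμ₀ : 0 ≤ μ)
    (hμ : ∀ a b, μ a * μ b ≤ μ (a ⊓ b) * μ (a ⊔ b)) (f : α) {j₁ j₂ : α} (hj₁ : SupPrime j₁) (hj₂ : SupPrime j₂)
    {A B : Finset α} (hA : IsUpperSet (A : Set α)) (hB : IsUpperSet (B : Set α)) :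
    0 ≤ latticeE3 μ A (principalUp (f ⊔ j₁) ∪ principalUp (f ⊔ j₂)) B := by
  rw [SahiC3Cube.latticeE3_comm₁₂]; exact latticeE3_nonneg_of_sup_supPrime_union hμ₀ hμ f hj₁ hj₂ hA hB

/-- The same slot in the third position. [this work] -/
theorem latticeE3_nonneg_of_sup_supPrime_union₃ {μ : α → ℝ} (hμ₀ : 0 ≤ μ)
    (hμ : ∀ a b, μ a * μ b ≤ μ (a ⊓ b) * μ (a ⊔ b)) (f : α) {j₁ j₂ : α} (hj₁ : SupPrime j₁) (hj₂ : SupPrime j₂)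
    {A B : Finset α} (hA : IsUpperSet (A : Set α)) (hB : IsUpperSet (B : Set α)) :
    0 ≤ latticeE3 μ A B (principalUp (f ⊔ j₁) ∪ principalUp (f ⊔ j₂)) := by
  rw [SahiC3Cube.latticeE3_comm₁₃]; exact latticeE3_nonneg_of_sup_supPrime_union hμ₀ hμ f hj₁ hj₂ hB hA



/-! ### Boolean form: the slot `{ω | S ⊆ ω, ω meets {a, b}}` on `2^ι` -/

section Boolean

variable {ι : Type*} [Fintype ι] [DecidableEq ι]

/-- `↑(S ∪ {a}) ∪ ↑(S ∪ {b}) = {ω | S ⊆ ω ∧ (a ∈ ω ∨ b ∈ ω)}` in `Finset ι`. [this work] -/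
theorem principalUp_sup_singleton_union (S : Finset ι) (a b : ι) :
    principalUp (S ⊔ {a}) ∪ principalUp (S ⊔ {b}) = univ.filter fun ω : Finset ι => S ⊆ ω ∧ (a ∈ ω ∨ b ∈ ω) := by
  ext ω
  simp only [Finset.mem_union, mem_principalUp, Finset.mem_filter, Finset.mem_univ, true_and, Finset.sup_eq_union,
    Finset.union_subset_iff, Finset.singleton_subset_iff]
  tauto

/-- **Sahi's `C₃` on `2^ι` for every FKG weight when one slot is `{ω | S ⊆ ω and ω meets {a, b}}`** (the conjunction `x_S` times the
hitting event of a two-element set; the other two slots arbitrary up-sets). [this work] -/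
theorem latticeE3_nonneg_conj_hit_pair {μ : Finset ι → ℝ} (hμ₀ : 0 ≤ μ) (hμ : ∀ s t, μ s * μ t ≤ μ (s ⊓ t) * μ (s ⊔ t))
    (S : Finset ι) (a b : ι) {A B : Finset (Finset ι)} (hA : IsUpperSet (A : Set (Finset ι)))
    (hB : IsUpperSet (B : Set (Finset ι))) :
    0 ≤ latticeE3 μ (univ.filter fun ω : Finset ι => S ⊆ ω ∧ (a ∈ ω ∨ b ∈ ω)) A B := by
  rw [← principalUp_sup_singleton_union]
  exact latticeE3_nonneg_of_sup_supPrime_union hμ₀ hμ S (SahiE3CovHit.supPrime_singleton' a)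
    (SahiE3CovHit.supPrime_singleton' b) hA hB

end Boolean

end Summit.CriticalPhenomena.PercolationContinuityZ3.Theorems.SahiE3FilterRestriction
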